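import Summits.Ventures.DiscreteObjects.MOLS.CompleteMOLSOfPlane

/-!
# `n - 1` MOLS(n) build a projective plane of order `n`; PP(12) ⇔ 11 MOLS(12) (kernel)
Framing: lottery ticket; floor = certified bounds/negative ranges.

Cell pub-namedobj (venture DiscreteObjects), target (M), designs gen 9.  Converse of `CompleteMOLSOfPlane` (Bose 1938): from a
family `Ls : ι → Fin n → Fin n → Fin n` of Latin squares, pairwise orthogonal, with `|ι| + 1 = n` and `2 ≤ n`, a Mathlib
`Configuration.ProjectivePlane` of order `n` is BUILT: points `MPt Ls` = the `n²` cells and one point at infinity per PARALLEL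
CLASS (`ι ⊕ Bool`: the squares, the rows, the columns); lines `MLn Ls` = (class, value) and the line at infinity; a cell lies on
`(c, s)` iff its value in class `c` (row index / column index / entry of square `c`) is `s`.  Two classes read a cell injectively
(`val_pair_injective`: Latin rows/columns, orthogonality), so two lines meet in exactly one point (`mkPoint` explicit) and
`|points| = |lines| = n² + n + 1` gives the joining lines (Mathlib `HasPoints.hasLines`); the line at infinity has `n + 1` points
(`order_planeOfMOLS`).  Consequence: **`existsPlaneOrder12_iff_eleven_MOLS`** — a projective plane of order 12 exists iff eleven
pairwise orthogonal Latin squares of order 12 exist (`ExistsProjectivePlaneOrder12`, typed here; target (M-b) of the census in its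
two classical forms, kernel-equivalent).  `IsLatinSquare` / `IsOrthogonalMate` are decidable on explicit squares, so eleven explicit
MOLS(12) would certify PP(12) in the kernel (the record is five, `FiveMOLS12`).  Formalisation ours; no `sorry`.
-/

namespace Summit.Ventures.DiscreteObjects.MOLS

open Finset Function Configuration Literature.Combinatorics.Designs.LatinSquares

section Build

variable {ι : Type*} {n : ℕ} (Ls : ι → Fin n → Fin n → Fin n)

/-- points: cells and one point at infinity per parallel class (`inl k` = square `k`, `inr false` = rows, `inr true` = columns) -/
inductive MPt (Ls : ι → Fin n → Fin n → Fin n) : Type _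
  | cell (i b : Fin n)
  | inf (c : ι ⊕ Bool)

/-- lines: (class, value) and the line at infinity -/
inductive MLn (Ls : ι → Fin n → Fin n → Fin n) : Type _
  | ln (c : ι ⊕ Bool) (s : Fin n)
  | linf

variable {Ls}

/-- the value of the cell `(i, b)` in the parallel class `c` -/
def val (Ls : ι → Fin n → Fin n → Fin n) : ι ⊕ Bool → Fin n → Fin n → Fin n
  | .inl k, i, b => Ls k i b
  | .inr false, i, _ => i
  | .inr true, _, b => b

/-- incidence -/
def MPt.Inc : MPt Ls → MLn Ls → Prop
  | .cell i b, .ln c s => val Ls c i b = s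
  | .cell _ _, .linf => False
  | .inf c', .ln c _ => c' = c
  | .inf _, .linf => True

/-- incidence as membership -/
instance : Membership (MPt Ls) (MLn Ls) := ⟨fun m x => MPt.Inc x m⟩

/-- a cell on a class line -/
@[simp] theorem cell_mem_ln {i b : Fin n} {c : ι ⊕ Bool} {s : Fin n} :
    (MPt.cell i b : MPt Ls) ∈ (MLn.ln c s : MLn Ls) ↔ val Ls c i b = s := Iff.rfl
/-- cells are off the line at infinity -/
@[simp] theorem cell_mem_linf {i b : Fin n} : (MPt.cell i b : MPt Ls) ∈ (MLn.linf : MLn Ls) ↔ False := Iff.rfl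
/-- a point at infinity on a class line -/
@[simp] theorem inf_mem_ln {c' c : ι ⊕ Bool} {s : Fin n} : (MPt.inf c' : MPt Ls) ∈ (MLn.ln c s : MLn Ls) ↔ c' = c := Iff.rfl
/-- points at infinity are on the line at infinity -/
@[simp] theorem inf_mem_linf {c : ι ⊕ Bool} : (MPt.inf c : MPt Ls) ∈ (MLn.linf : MLn Ls) ↔ True := Iff.rfl

variable (hL : ∀ k, IsLatinSquare (Ls k)) (hO : ∀ k k', k ≠ k' → IsOrthogonalMate (Ls k) (Ls k'))
include hL hO

/-- **Two distinct parallel classes read the cells injectively** (Latin rows / columns, orthogonality). -/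
theorem val_pair_injective {c c' : ι ⊕ Bool} (hcc : c ≠ c') :
    Injective fun x : Fin n × Fin n => (val Ls c x.1 x.2, val Ls c' x.1 x.2) := by
  rintro ⟨i, b⟩ ⟨i', b'⟩ h
  simp only [Prod.mk.injEq] at h
  obtain ⟨h1, h2⟩ := h
  rcases c with k | (_ | _) <;> rcases c' with k' | (_ | _) <;> simp only [val] at h1 h2
  · -- two squares: orthogonality
    have hkk : k ≠ k' := fun e => hcc (by rw [e])
    exact hO k k' hkk (a₁ := (i, b)) (a₂ := (i', b')) (Prod.ext h1 h2)
  · subst h2; exact Prod.ext rfl ((hL k).1 i h1)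
  · subst h2; exact Prod.ext ((hL k).2 b h1) rfl
  · subst h1; exact Prod.ext rfl ((hL k').1 i h2)
  · exact absurd rfl hcc
  · subst h1; subst h2; rfl
  · subst h1; exact Prod.ext ((hL k').2 b h2) rfl
  · subst h1; subst h2; rfl
  · exact absurd rfl hcc

/-- hence bijectively -/
theorem val_pair_bijective {c c' : ι ⊕ Bool} (hcc : c ≠ c') :
    Bijective fun x : Fin n × Fin n => (val Ls c x.1 x.2, val Ls c' x.1 x.2) :=
  (Finite.injective_iff_bijective.mp (val_pair_injective hL hO hcc))

/-- **Two distinct lines meet.** -/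
theorem exists_meet (l₁ l₂ : MLn Ls) (h : l₁ ≠ l₂) : ∃ x : MPt Ls, x ∈ l₁ ∧ x ∈ l₂ := by
  rcases l₁ with ⟨c, s⟩ | _ <;> rcases l₂ with ⟨c', s'⟩ | _
  · by_cases hcc : c = c'
    · subst hcc; exact ⟨MPt.inf c, by simp, by simp⟩
    · obtain ⟨⟨i, b⟩, hib⟩ := (val_pair_bijective hL hO hcc).2 (s, s')
      simp only [Prod.mk.injEq] at hib
      exact ⟨MPt.cell i b, hib.1, hib.2⟩
  · exact ⟨MPt.inf c, by simp, by simp⟩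
  · exact ⟨MPt.inf c', by simp, by simp⟩
  · exact absurd rfl h

/-- **Two points lie on at most one line.** -/
theorem eq_or_eq_MOLS {p₁ p₂ : MPt Ls} {l₁ l₂ : MLn Ls} (h1 : p₁ ∈ l₁) (h2 : p₂ ∈ l₁) (h3 : p₁ ∈ l₂) (h4 : p₂ ∈ l₂) :
    p₁ = p₂ ∨ l₁ = l₂ := by
  rcases l₁ with ⟨c, s⟩ | _ <;> rcases l₂ with ⟨c', s'⟩ | _
  · by_cases hl : (MLn.ln c s : MLn Ls) = MLn.ln c' s'
    · exact Or.inr hl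
    left
    by_cases hcc : c = c'
    · subst hcc
      have hss : s ≠ s' := fun e => hl (by rw [e])
      rcases p₁ with ⟨i, b⟩ | d <;> rcases p₂ with ⟨i', b'⟩ | d'
      · simp only [cell_mem_ln] at h1 h3; exact absurd (h1.symm.trans h3) hss
      · simp only [cell_mem_ln] at h1 h3; exact absurd (h1.symm.trans h3) hss
      · simp only [cell_mem_ln] at h2 h4; exact absurd (h2.symm.trans h4) hss
      · simp only [inf_mem_ln] at h1 h2; rw [h1, h2]
    · rcases p₁ with ⟨i, b⟩ | d <;> rcases p₂ with ⟨i', b'⟩ | d'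
      · simp only [cell_mem_ln] at h1 h2 h3 h4
        have e := val_pair_injective hL hO hcc (a₁ := (i, b)) (a₂ := (i', b'))
          (by simp only [Prod.mk.injEq]; exact ⟨h1.trans h2.symm, h3.trans h4.symm⟩)
        simp only [Prod.mk.injEq] at e
        rw [e.1, e.2]
      · simp only [inf_mem_ln] at h2 h4; exact absurd (h2.symm.trans h4) hcc
      · simp only [inf_mem_ln] at h1 h3; exact absurd (h1.symm.trans h3) hcc
      · simp only [inf_mem_ln] at h1 h3; exact absurd (h1.symm.trans h3) hcc
  · left
    rcases p₁ with ⟨i, b⟩ | d <;> rcases p₂ with ⟨i', b'⟩ | d'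
    · exact absurd h3 (by simp)
    · exact absurd h3 (by simp)
    · exact absurd h4 (by simp)
    · simp only [inf_mem_ln] at h1 h2; rw [h1, h2]
  · left
    rcases p₁ with ⟨i, b⟩ | d <;> rcases p₂ with ⟨i', b'⟩ | d'
    · exact absurd h1 (by simp)
    · exact absurd h1 (by simp)
    · exact absurd h2 (by simp)
    · simp only [inf_mem_ln] at h3 h4; rw [h3, h4]
  · exact Or.inr rfl

omit hL hO in
/-- the points as a sum type (finiteness) -/
def MPt.equivSum : MPt Ls ≃ (Fin n × Fin n) ⊕ (ι ⊕ Bool) where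
  toFun x := match x with | .cell i b => Sum.inl (i, b) | .inf c => Sum.inr c
  invFun y := match y with | Sum.inl (i, b) => .cell i b | Sum.inr c => .inf c
  left_inv := by rintro (⟨i, b⟩ | c) <;> rfl
  right_inv := by rintro (⟨i, b⟩ | c) <;> rfl

omit hL hO in
/-- the lines as a sum type (finiteness) -/
def MLn.equivSum : MLn Ls ≃ ((ι ⊕ Bool) × Fin n) ⊕ Unit where
  toFun x := match x with | .ln c s => Sum.inl (c, s) | .linf => Sum.inr ()
  invFun y := match y with | Sum.inl (c, s) => .ln c s | Sum.inr _ => .linf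
  left_inv := by rintro (⟨c, s⟩ | _) <;> rfl
  right_inv := by rintro (⟨c, s⟩ | ⟨⟩) <;> rfl

variable [Fintype ι]

omit hL hO in
/-- the points form a finite type -/
instance : Fintype (MPt Ls) := Fintype.ofEquiv _ MPt.equivSum.symm

omit hL hO in
/-- the lines form a finite type -/
instance : Fintype (MLn Ls) := Fintype.ofEquiv _ MLn.equivSum.symm

omit hL hO in
/-- with `|ι| + 1 = n` there are `n² + n + 1` points and as many lines -/
theorem card_MPt_eq_card_MLn (hι : Fintype.card ι + 1 = n) : Fintype.card (MPt Ls) = Fintype.card (MLn Ls) := by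
  rw [Fintype.card_congr (MPt.equivSum (Ls := Ls)), Fintype.card_congr (MLn.equivSum (Ls := Ls))]
  simp only [Fintype.card_sum, Fintype.card_prod, Fintype.card_fin, Fintype.card_bool, Fintype.card_unit]
  subst hι
  ring

omit hL hO in
/-- the line at infinity carries exactly the `|ι| + 2` points at infinity -/
theorem natCard_mem_linf : Nat.card {x : MPt Ls // x ∈ (MLn.linf : MLn Ls)} = Fintype.card ι + 2 := by
  let e : {x : MPt Ls // x ∈ (MLn.linf : MLn Ls)} ≃ ι ⊕ Bool :=
    { toFun := fun x => match x with | ⟨.cell _ _, h⟩ => (h : False).elim | ⟨.inf c, _⟩ => c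
      invFun := fun c => ⟨.inf c, trivial⟩
      left_inv := by rintro ⟨⟨i, b⟩ | c, h⟩ <;> first | exact (h : False).elim | rfl
      right_inv := by intro c; rfl }
  rw [Nat.card_congr e, Nat.card_eq_fintype_card, Fintype.card_sum, Fintype.card_bool]

/-- **Two distinct lines meet in a point; the structure is nondegenerate** (needs `2 ≤ n`). -/
@[reducible] noncomputable def hasPointsOfMOLS (hn : 2 ≤ n) : HasPoints (MPt Ls) (MLn Ls) where
  exists_point := by
    rintro (⟨c, s⟩ | _)
    · rcases c with k | (_ | _)
      · exact ⟨MPt.inf (Sum.inr false), by simp⟩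
      · exact ⟨MPt.inf (Sum.inr true), by simp⟩
      · exact ⟨MPt.inf (Sum.inr false), by simp⟩
    · exact ⟨MPt.cell ⟨0, by omega⟩ ⟨0, by omega⟩, by simp⟩
  exists_line := by
    rintro (⟨i, b⟩ | c)
    · exact ⟨MLn.linf, by simp⟩
    · rcases c with k | (_ | _)
      · exact ⟨MLn.ln (Sum.inr false) ⟨0, by omega⟩, by simp⟩
      · exact ⟨MLn.ln (Sum.inr true) ⟨0, by omega⟩, by simp⟩
      · exact ⟨MLn.ln (Sum.inr false) ⟨0, by omega⟩, by simp⟩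
  eq_or_eq := fun h1 h2 h3 h4 => eq_or_eq_MOLS hL hO h1 h2 h3 h4
  mkPoint := fun {l₁ l₂} h => Classical.choose (exists_meet hL hO l₁ l₂ h)
  mkPoint_ax := fun {l₁ l₂} h => Classical.choose_spec (exists_meet hL hO l₁ l₂ h)

/-- **`n - 1` MOLS(n) build a projective plane.** -/
@[reducible] noncomputable def planeOfMOLS (hn : 2 ≤ n) (hι : Fintype.card ι + 1 = n) :
    ProjectivePlane (MPt Ls) (MLn Ls) :=
  let hP : HasPoints (MPt Ls) (MLn Ls) := hasPointsOfMOLS hL hO hn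
  let hL' : HasLines (MPt Ls) (MLn Ls) := @HasPoints.hasLines _ _ _ hP _ _ (card_MPt_eq_card_MLn hι)
  { hP, hL' with
    exists_config := by
      refine ⟨MPt.cell ⟨1, by omega⟩ ⟨0, by omega⟩, MPt.inf (Sum.inr false), MPt.cell ⟨0, by omega⟩ ⟨0, by omega⟩,
        MLn.ln (Sum.inr true) ⟨1, by omega⟩, MLn.ln (Sum.inr false) ⟨0, by omega⟩, MLn.linf,
        ?_, ?_, ?_, ?_, ?_, ?_, ?_, ?_⟩ <;> simp [val, Fin.ext_iff] }

/-- **The plane built from `n - 1` MOLS(n) has order `n`.** -/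
theorem order_planeOfMOLS (hn : 2 ≤ n) (hι : Fintype.card ι + 1 = n) :
    @ProjectivePlane.order (MPt Ls) (MLn Ls) _ (planeOfMOLS hL hO hn hι) = n := by
  letI := planeOfMOLS hL hO hn hι
  have h : Nat.card {x : MPt Ls // x ∈ (MLn.linf : MLn Ls)} = ProjectivePlane.order (MPt Ls) (MLn Ls) + 1 :=
    ProjectivePlane.pointCount_eq (MPt Ls) (MLn.linf : MLn Ls)
  rw [natCard_mem_linf] at h
  omega

end Build

/-! ### PP(12) ⇔ 11 MOLS(12) -/

/-- **Census target (M-b), typed:** a projective plane of order 12 exists. -/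
def ExistsProjectivePlaneOrder12 : Prop :=
  ∃ (P L : Type) (_ : Membership P L) (_ : Fintype P) (_ : Fintype L) (_ : ProjectivePlane P L),
    ProjectivePlane.order P L = 12

/-- **PP(12) ⇔ 11 MOLS(12) (kernel).**  A projective plane of order 12 exists iff there are eleven Latin squares of order 12
that are pairwise orthogonal. -/
theorem existsPlaneOrder12_iff_eleven_MOLS :
    ExistsProjectivePlaneOrder12 ↔ ∃ Ls : Fin 11 → Fin 12 → Fin 12 → Fin 12,
      (∀ k, IsLatinSquare (Ls k)) ∧ ∀ k k', k ≠ k' → IsOrthogonalMate (Ls k) (Ls k') := by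
  constructor
  · rintro ⟨P, L, _, _, _, _, h12⟩
    obtain ⟨Ls, hL, hO⟩ := exists_eleven_MOLS_of_order12 (P := P) (L := L) h12
    refine ⟨fun k => Ls ⟨k.succ, Fin.succ_ne_zero k⟩, fun k => hL _, fun k k' hkk => hO _ _ ?_⟩
    intro e
    exact hkk (Fin.succ_injective _ (congrArg Subtype.val e))
  · rintro ⟨Ls, hL, hO⟩
    exact ⟨MPt Ls, MLn Ls, inferInstance, inferInstance, inferInstance, planeOfMOLS hL hO (by norm_num) (by simp),
      order_planeOfMOLS hL hO (by norm_num) (by simp)⟩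

end Summit.Ventures.DiscreteObjects.MOLS
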